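import Literature.AlgebraicGeometry.Surfaces.PolarisedK3TwinKuranishiFamily
import Literature.AlgebraicGeometry.Surfaces.K3PeriodSurjectivityProofs
import Literature.AlgebraicGeometry.Surfaces.K3TwistorLines
import Summits.HodgeConjecture.HodgeConjecture.Theses.NikulinTwinTransport

/-!
# Crux `K3PeriodSurjective` (stmt-HodgeConjecture-15154) — skeleton of line `IdeatorOneSketch`
# (idea card `ratner-orbit-closure-cm-seed`, lever A: orbit closures + CM seeds + local Torelli)

Lead prover `prover-line-stmt-HodgeConjecture-15154-0`. The crux (route NikulinTwinTransport, rank 8)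
is, definitionally, the named Literature fact `Huybrechts_K3_periodSurjective_projective`
(surjectivity of the period map for PROJECTIVE K3 surfaces, Huybrechts *Lectures on K3 Surfaces*
Ch. 6 Thm. 3.1 / Rem. 3.3, Ch. 7 Thm. 4.1, Ch. 1 §3): every projective period vector `x ∈ Λ_ℂ`
(`x² = 0`, `x̄.x > 0`, some integral `v ⊥ x` with `v² > 0`) is REALISED by a marked algebraic K3
surface.

## The line

* `stub_orbitClosureMeetsCM` (T1, pure homogeneous dynamics: Ratner 1991 / Verbitsky 2015 Thm. 4.8 +
  erratum 2017 §2.3 for `O(Λ_{K3}) ↷ SO(3,19)/SO(2)×SO(1,19)`): every `O(Λ)×ℂˣ`-orbit closure in the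
  period domain contains a CM point (`rank (Λ ∩ y^⊥) = 20`, i.e. a rational positive 2-plane).
* `stub_cmPeriod_realised` (T2a, Shioda–Inose 1977 / Huybrechts Ch. 14 Cor. 3.21, Rem. 3.22 + the
  marking extension Cor. 14.3.10): every CM period vector is realised.
* `stub_realised_locallySurjective` (T2b, Kuranishi family + local Torelli, Huybrechts Ch. 6 Cor. 2.7 /
  Prop. 2.8, projectivity criterion Ch. 1 §3 = BHPV IV.6.2, GAGA Ch. 1 Prop. 3.2): around a realised
  period vector every PROJECTIVE period vector is realised.
* `stub_orbitInvariance` (T3, in-tree: `Huybrechts_K3_periodSurjective_projective.conclusion_smul`,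
  `.conclusion_of_latticeIsometry`, `.hypotheses_smul`, `.hypotheses_of_latticeIsometry`,
  `isUnit_of_k3Isometry`): projectivity is pushed forward and realisability pulled back along
  `x ↦ t • g x`.

`K3PeriodSurjective_of` composes them (the covering argument of the card, kernel-checked): the orbit
of `x` accumulates at a CM point `y` (T1); `y` is realised (T2a); so every projective period near `y`
is realised (T2b); some `t • g x` is near `y` and projective (T3), hence realised; pull back (T3).

All four stub signatures are SELF-CONTAINED (Literature + Mathlib vocabulary only), so that each can be
proved verbatim in its own `Theorems/NikulinTwinTransportK3PeriodSurjective<Stub>.lean`.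
-/

noncomputable section

set_option linter.dupNamespace false

open scoped Matrix Topology
open Literature.AlgebraicGeometry Literature.AlgebraicGeometry.Surfaces
  Literature.AlgebraicGeometry.HodgeTheory

namespace Summit.HodgeConjecture.HodgeConjecture.Cruxes.K3PeriodSurjective.OrbitClosure

/-! ## Vocabulary (abbreviations of the stub signatures; not used IN the signatures) -/

/-- `Realised x`: the conclusion of the crux at the period vector `x` — a projective K3 surface
with a marking under which `x` spans `H^{2,0}`. -/
def Realised (x : K3Index → ℂ) : Prop :=
  ∃ (S : Motives.SchemeOver ℂ) (_ : IsK3Surface S)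
    (φ : complexBetti S (2 * 1) ≃ₗ[ℂ] (K3Index → ℂ)) (p : complexBetti S (2 * 2)), IsMarkedK3 S φ p x

/-- A projective period vector: `x ∈ D` with an integral `v ⊥ x`, `v² > 0`. -/
def IsProjectivePeriod (x : K3Index → ℂ) : Prop :=
  x ∈ k3PeriodDomain ∧
    ∃ v : K3Index → ℤ, k3Form (fun i => (v i : ℂ)) x = 0 ∧ 0 < ∑ i, ∑ j, v i * k3Gram i j * v j

/-- The `O(Λ) × ℂˣ`-orbit of a vector of `Λ_ℂ`. -/
def orbitCone (x : K3Index → ℂ) : Set (K3Index → ℂ) :=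
  {z | ∃ (g : Matrix K3Index K3Index ℤ) (t : ℂ), g.transpose * k3Gram * g = k3Gram ∧ IsUnit g ∧
      t ≠ 0 ∧ z = t • (g.map (Int.cast : ℤ → ℂ) *ᵥ x)}

/-- A CM (`ρ = 20`, "singular K3") period vector: twenty independent lattice vectors orthogonal to
it, i.e. the positive plane `⟨Re y, Im y⟩` is rational. -/
def IsCMPeriod (y : K3Index → ℂ) : Prop :=
  ∃ N : Fin 20 → (K3Index → ℤ), LinearIndependent ℤ N ∧ ∀ k, k3Form (fun i => (N k i : ℂ)) y = 0

/-- The crux, reread: every projective period vector is realised (definitional). -/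
theorem crux_iff :
    Theses.NikulinTwinTransport.K3PeriodSurjective ↔ ∀ x, IsProjectivePeriod x → Realised x := by
  constructor
  · rintro h x ⟨⟨h1, h2⟩, h3⟩
    exact h x h1 h2 h3
  · intro h x h1 h2 h3
    exact h x ⟨⟨h1, h2⟩, h3⟩

/-! ## The registered stubs (self-contained signatures) -/

/-- **T1 · orbit closures meet the CM locus** (Verbitsky 2015 Thm. 4.8 + erratum arXiv:1708.05802
§2.3, via Ratner 1991, for the arithmetic lattice `O(Λ_{K3}) ⊂ O(3,19)`): for every period vector `x`
the closure of its `O(Λ) × ℂˣ`-orbit contains a period vector `y` with twenty independent lattice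
vectors orthogonal to it. Pure homogeneous dynamics; no K3 geometry. -/
theorem stub_orbitClosureMeetsCM : ∀ x : K3Index → ℂ, x ∈ k3PeriodDomain → ∃ y : K3Index → ℂ, y ∈ closure {z : K3Index → ℂ | ∃ (g : Matrix K3Index K3Index ℤ) (t : ℂ), g.transpose * k3Gram * g = k3Gram ∧ IsUnit g ∧ t ≠ 0 ∧ z = t • (g.map (Int.cast : ℤ → ℂ) *ᵥ x)} ∧ y ∈ k3PeriodDomain ∧ ∃ N : Fin 20 → (K3Index → ℤ), LinearIndependent ℤ N ∧ ∀ k : Fin 20, k3Form (fun i => (N k i : ℂ)) y = 0 := by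
  sorry

/-- **T2a · CM period vectors are realised** (Shioda–Inose 1977: every positive definite even
oriented rank-2 lattice is the transcendental lattice of a projective K3 surface with `ρ = 20`, the
double cover of a Kummer surface of a product of CM elliptic curves; Huybrechts Ch. 14 Cor. 3.21,
Rem. 3.22; the marking is extended from `T` to `Λ` by Nikulin, Huybrechts Ch. 14 Cor. 3.10). -/
theorem stub_cmPeriod_realised : ∀ y : K3Index → ℂ, y ∈ k3PeriodDomain → (∃ N : Fin 20 → (K3Index → ℤ), LinearIndependent ℤ N ∧ ∀ k : Fin 20, k3Form (fun i => (N k i : ℂ)) y = 0) → ∃ (S : Motives.SchemeOver ℂ) (_ : IsK3Surface S) (φ : complexBetti S (2 * 1) ≃ₗ[ℂ] (K3Index → ℂ)) (p : complexBetti S (2 * 2)), IsMarkedK3 S φ p y := by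
  sorry

/-- **T2b · local surjectivity at a realised period** (the Kuranishi family of the realising surface
is universal with period map a local isomorphism onto an open subset of the 20-dimensional period
domain, Huybrechts Ch. 6 Cor. 2.7 / Prop. 2.8; a small deformation carrying an integral `(1,1)`-class
of positive square is projective, Ch. 1 §3 = BHPV IV Thm. 6.2, hence algebraic with the same `H²`,
cup form and Hodge types by Chow/GAGA, Ch. 1 Prop. 3.2, and it inherits the transported marking). -/
theorem stub_realised_locallySurjective : ∀ y : K3Index → ℂ, (∃ (S : Motives.SchemeOver ℂ) (_ : IsK3Surface S) (φ : complexBetti S (2 * 1) ≃ₗ[ℂ] (K3Index → ℂ)) (p : complexBetti S (2 * 2)), IsMarkedK3 S φ p y) → ∃ W ∈ 𝓝 y, ∀ z ∈ W, z ∈ k3PeriodDomain → (∃ v : K3Index → ℤ, k3Form (fun i => (v i : ℂ)) z = 0 ∧ 0 < ∑ i, ∑ j, v i * k3Gram i j * v j) → ∃ (S : Motives.SchemeOver ℂ) (_ : IsK3Surface S) (φ : complexBetti S (2 * 1) ≃ₗ[ℂ] (K3Index → ℂ)) (p : complexBetti S (2 * 2)), IsMarkedK3 S φ p z := by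
  sorry

/-- **T3 · orbit invariance** (in-tree lemmas `Huybrechts_K3_periodSurjective_projective.hypotheses_smul`,
`.hypotheses_of_latticeIsometry`, `.conclusion_smul`, `.conclusion_of_latticeIsometry`,
`isUnit_of_k3Isometry`): along `x ↦ t • g x` (`g ∈ O(Λ)`, `t ≠ 0`) projectivity is pushed forward and
realisability is pulled back. -/
theorem stub_orbitInvariance : ∀ (x : K3Index → ℂ) (g : Matrix K3Index K3Index ℤ) (t : ℂ), g.transpose * k3Gram * g = k3Gram → IsUnit g → t ≠ 0 → ((x ∈ k3PeriodDomain ∧ ∃ v : K3Index → ℤ, k3Form (fun i => (v i : ℂ)) x = 0 ∧ 0 < ∑ i, ∑ j, v i * k3Gram i j * v j) → (t • (g.map (Int.cast : ℤ → ℂ) *ᵥ x) ∈ k3PeriodDomain ∧ ∃ v : K3Index → ℤ, k3Form (fun i => (v i : ℂ)) (t • (g.map (Int.cast : ℤ → ℂ) *ᵥ x)) = 0 ∧ 0 < ∑ i, ∑ j, v i * k3Gram i j * v j)) ∧ ((∃ (S : Motives.SchemeOver ℂ) (_ : IsK3Surface S) (φ : complexBetti S (2 * 1) ≃ₗ[ℂ]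 (K3Index → ℂ)) (p : complexBetti S (2 * 2)), IsMarkedK3 S φ p (t • (g.map (Int.cast : ℤ → ℂ) *ᵥ x))) → ∃ (S : Motives.SchemeOver ℂ) (_ : IsK3Surface S) (φ : complexBetti S (2 * 1) ≃ₗ[ℂ] (K3Index → ℂ)) (p : complexBetti S (2 * 2)), IsMarkedK3 S φ p x) := by
  sorry

/-! ## The stubs in the vocabulary of the card -/

/-- T1 in the card's vocabulary. -/
theorem orbitClosure_meets_CM :
    ∀ x ∈ k3PeriodDomain, ∃ y ∈ closure (orbitCone x), y ∈ k3PeriodDomain ∧ IsCMPeriod y :=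
  fun x hx => by
    obtain ⟨y, hy, hyD, hN⟩ := stub_orbitClosureMeetsCM x hx
    exact ⟨y, hy, hyD, hN⟩

/-- T2 = T2a + T2b in the card's vocabulary: local surjectivity at CM points. -/
theorem locallySurjective_at_CM :
    ∀ y ∈ k3PeriodDomain, IsCMPeriod y → ∃ W ∈ 𝓝 y, ∀ z ∈ W, IsProjectivePeriod z → Realised z :=
  fun y hyD hyCM => by
    obtain ⟨W, hW, h⟩ := stub_realised_locallySurjective y (stub_cmPeriod_realised y hyD hyCM)
    exact ⟨W, hW, fun z hz hzP => h z hz hzP.1 hzP.2⟩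

/-- T3 in the card's vocabulary. -/
theorem orbit_invariance :
    ∀ (x : K3Index → ℂ) (g : Matrix K3Index K3Index ℤ) (t : ℂ),
      g.transpose * k3Gram * g = k3Gram → IsUnit g → t ≠ 0 →
        (IsProjectivePeriod x → IsProjectivePeriod (t • (g.map (Int.cast : ℤ → ℂ) *ᵥ x))) ∧
        (Realised (t • (g.map (Int.cast : ℤ → ℂ) *ᵥ x)) → Realised x) :=
  fun x g t hg hu ht => stub_orbitInvariance x g t hg hu ht

/-! ## Composition: the covering argument, kernel-checked -/

/-- **The crux from the four stubs** (covering argument of the card `ratner-orbit-closure-cm-seed`):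
the orbit of a projective period vector `x` accumulates at a CM point `y` (T1); `y` is realised (T2a),
so every projective period vector in a neighbourhood `W` of `y` is realised (T2b); an orbit point
`t • g x ∈ W` is projective (T3), hence realised, and realisability pulls back to `x` (T3). -/
theorem K3PeriodSurjective_of : Theses.NikulinTwinTransport.K3PeriodSurjective := by
  rw [crux_iff]
  intro x hx
  obtain ⟨y, hycl, hyD, hyCM⟩ := orbitClosure_meets_CM x hx.1
  obtain ⟨W, hW, hWreal⟩ := locallySurjective_at_CM y hyD hyCM
  obtain ⟨V, hVW, hVo, hyV⟩ := mem_nhds_iff.1 hW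
  obtain ⟨z, hzV, g, t, hg, hu, ht, rfl⟩ := mem_closure_iff_nhds.1 hycl V (hVo.mem_nhds hyV)
  exact (orbit_invariance x g t hg hu ht).2
    (hWreal _ (hVW hzV) ((orbit_invariance x g t hg hu ht).1 hx))

end Summit.HodgeConjecture.HodgeConjecture.Cruxes.K3PeriodSurjective.OrbitClosure

end
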